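import Summits.QuantumFields.QCD.Theses.SpectralDefectExtinction
import Literature.MathematicalPhysics.QuantumFieldTheory.QCDPhaseQuenched
import Literature.MathematicalPhysics.QuantumLattice.WilsonDiracAP
import Summits.QuantumFields.QCD.Theorems.HeatSlicedQuarksInterleavedFlowProperStubFineWeightAdmissibleSymm

/-!
# Stub Σ `stub_seaWeightSymmetric` — measurability and hypercubic symmetries of the honest
all-antiperiodic sea weight (crux stmt-QuantumFields-18064 `ExtinctionBuildsQCD`, line
`block-away-the-sign`, registered line lemma of Stub C's SeaAdmissible)

For the SD⁺ witness data `(reg, m)`, step `k` and torus side `2S+1`, the honest `N_f`-flavour sea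
weight in the currency of the node `HeavyThresholdYMBridge.RobustYangMillsRG` (rev 3),
`w(U) = exp(−β_k S_W(U)) · Re ∏_f det D_W^{AP}(U, m_f(k))` with quarks antiperiodic in ALL four
directions (`Literature.MathematicalPhysics.QuantumLattice.wilsonDiracAP`), is measurable and
invariant under lattice gauge transformations, torus translations, the link time reflection
`GaugeConfig.timeReflect` and all axis permutations — clauses (h-meas), (h-gauge), (h-transl),
(h-refl), (h-perm) of the node's `AdmAt`.

Proof: clauses (h-meas), (h-transl), (h-refl), (h-perm) are the landed fine-weight lemma
`InterleavedFlowProper.OffsetLastFormatHandover.stubFW_symm` of the HeatSlicedQuarks line (same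
weight, same node), instantiated at `β = β_k`, `m_f = m_crit(k) + a_k m_f / Z_m(k)`; the gauge
clause is the tree's `wilsonAction_gaugeTransform` and `fermionDet_wilsonDiracAP_gaugeTransform`.

References: K. Osterwalder, E. Seiler, Ann. Phys. 110 (1978) 440, §2; I. Montvay, G. Münster,
*Quantum Fields on a Lattice* (1994), §4.2.4, §5.1.1.
-/

noncomputable section

namespace Summit.QuantumFields.QCD.Cruxes.ExtinctionBuildsQCD.BlockAwayTheSign

open scoped BigOperators Topology Classical MeasureTheory Matrix
open Filter MeasureTheory Matrix
open Literature.MathematicalPhysics.QuantumLattice Literature.MathematicalPhysics.AQFT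
  Literature.MathematicalPhysics.QuantumFieldTheory
open Summit.QuantumFields.QCD.Theses.SpectralDefectExtinction
open Summit.QuantumFields.QCD.Theses

/-- **The gauge clause**: the honest all-antiperiodic sea weight is invariant under lattice gauge
transformations (`wilsonAction_gaugeTransform`, `fermionDet_wilsonDiracAP_gaugeTransform`).
[cite: MontvayMunster1994, §5.1.1] -/
theorem seaWeight_gaugeTransform {Nf : ℕ} (β : ℝ) (mq : Fin Nf → ℝ) {S : ℕ}
    (g : Site 4 (2 * S + 1) → SU3) (U : GaugeConfig 4 (2 * S + 1) SU3) :
    Real.exp (-(β * wilsonAction (fundamentalRep (Fin 3)) (gaugeTransform g U))) *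
        (∏ fl : Fin Nf, fermionDet (Literature.MathematicalPhysics.QuantumLattice.wilsonDiracAP
          (gaugeTransform g U) (mq fl))).re =
      Real.exp (-(β * wilsonAction (fundamentalRep (Fin 3)) U)) *
        (∏ fl : Fin Nf, fermionDet (Literature.MathematicalPhysics.QuantumLattice.wilsonDiracAP
          U (mq fl))).re := by
  simp only [wilsonAction_gaugeTransform, fermionDet_wilsonDiracAP_gaugeTransform]

/-- **Stub Σ `stub_seaWeightSymmetric` — measurability and hypercubic symmetries of the honest
all-antiperiodic sea weight (registered line lemma of Stub C's SeaAdmissible).** For the SD⁺ witness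
data `(reg, m)`, step `k` and torus side `2S+1`, the honest `N_f`-flavour sea weight in the node's own
currency, `w(U) = exp(−β_k S_W(U)) · Re ∏_f det D_W^{AP}(U, m_f(k))`
(`Literature.MathematicalPhysics.QuantumLattice.wilsonDiracAP`: quarks antiperiodic in ALL four
directions), is measurable and invariant under lattice gauge transformations, all torus translations,
the time reflection `GaugeConfig.timeReflect` and all axis permutations — clauses (h-meas), (h-gauge),
(h-transl), (h-refl), (h-perm) of `RobustYangMillsRG`'s `AdmAt` (rev 3). Clauses 1, 3, 4, 5 are the
landed fine-weight lemma `stubFW_symm` of the HeatSlicedQuarks line (crux stmt-QuantumFields-18031),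
clause 2 is `seaWeight_gaugeTransform`. [cite: MontvayMunster1994, §4.2.4 and §5.1.1]
[cite: OsterwalderSeiler1978, §2] -/
theorem stub_seaWeightSymmetric :
    ∀ {Nf : ℕ} (reg : QCDRegularisation Nf) (m : Fin Nf → ℝ) (k S : ℕ),
      Measurable (fun U : GaugeConfig 4 (2 * S + 1) SU3 =>
          Real.exp (-(reg.β k * wilsonAction (fundamentalRep (Fin 3)) U)) *
            (∏ fl : Fin Nf, fermionDet (Literature.MathematicalPhysics.QuantumLattice.wilsonDiracAP U (reg.mcrit k + reg.a k * m fl / reg.Zm k))).re) ∧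
      (∀ (g : Site 4 (2 * S + 1) → SU3) (U : GaugeConfig 4 (2 * S + 1) SU3),
          Real.exp (-(reg.β k * wilsonAction (fundamentalRep (Fin 3)) (gaugeTransform g U))) *
            (∏ fl : Fin Nf, fermionDet (Literature.MathematicalPhysics.QuantumLattice.wilsonDiracAP (gaugeTransform g U) (reg.mcrit k + reg.a k * m fl / reg.Zm k))).re =
          Real.exp (-(reg.β k * wilsonAction (fundamentalRep (Fin 3)) U)) *
            (∏ fl : Fin Nf, fermionDet (Literature.MathematicalPhysics.QuantumLattice.wilsonDiracAP U (reg.mcrit k + reg.a k * m fl / reg.Zm k))).re) ∧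
      (∀ (v : Site 4 (2 * S + 1)) (U : GaugeConfig 4 (2 * S + 1) SU3),
          Real.exp (-(reg.β k * wilsonAction (fundamentalRep (Fin 3)) (torusConfigShift v U))) *
            (∏ fl : Fin Nf, fermionDet (Literature.MathematicalPhysics.QuantumLattice.wilsonDiracAP (torusConfigShift v U) (reg.mcrit k + reg.a k * m fl / reg.Zm k))).re =
          Real.exp (-(reg.β k * wilsonAction (fundamentalRep (Fin 3)) U)) *
            (∏ fl : Fin Nf, fermionDet (Literature.MathematicalPhysics.QuantumLattice.wilsonDiracAP U (reg.mcrit k + reg.a k * m fl / reg.Zm k))).re) ∧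
      (∀ U : GaugeConfig 4 (2 * S + 1) SU3,
          Real.exp (-(reg.β k * wilsonAction (fundamentalRep (Fin 3)) (GaugeConfig.timeReflect U))) *
            (∏ fl : Fin Nf, fermionDet (Literature.MathematicalPhysics.QuantumLattice.wilsonDiracAP (GaugeConfig.timeReflect U) (reg.mcrit k + reg.a k * m fl / reg.Zm k))).re =
          Real.exp (-(reg.β k * wilsonAction (fundamentalRep (Fin 3)) U)) *
            (∏ fl : Fin Nf, fermionDet (Literature.MathematicalPhysics.QuantumLattice.wilsonDiracAP U (reg.mcrit k + reg.a k * m fl / reg.Zm k))).re) ∧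
      (∀ (π : Equiv.Perm (Fin 4)) (U : GaugeConfig 4 (2 * S + 1) SU3),
          Real.exp (-(reg.β k * wilsonAction (fundamentalRep (Fin 3)) (U ∘ fun e => (e.1 ∘ π, π.symm e.2)))) *
            (∏ fl : Fin Nf, fermionDet (Literature.MathematicalPhysics.QuantumLattice.wilsonDiracAP (U ∘ fun e => (e.1 ∘ π, π.symm e.2)) (reg.mcrit k + reg.a k * m fl / reg.Zm k))).re =
          Real.exp (-(reg.β k * wilsonAction (fundamentalRep (Fin 3)) U)) *
            (∏ fl : Fin Nf, fermionDet (Literature.MathematicalPhysics.QuantumLattice.wilsonDiracAP U (reg.mcrit k + reg.a k * m fl / reg.Zm k))).re) := by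
  intro Nf reg m k S
  obtain ⟨h1, h3, h4, h5⟩ :=
    Summit.QuantumFields.QCD.Cruxes.InterleavedFlowProper.OffsetLastFormatHandover.stubFW_symm
      (2 * S + 1) Nf (reg.β k) (fun fl => reg.mcrit k + reg.a k * m fl / reg.Zm k)
  exact ⟨h1, fun g U => seaWeight_gaugeTransform (reg.β k) (fun fl => reg.mcrit k + reg.a k * m fl / reg.Zm k) g U,
    h3, h4, h5⟩

end Summit.QuantumFields.QCD.Cruxes.ExtinctionBuildsQCD.BlockAwayTheSign

end
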